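import Summits.ResolutionOfSingularities.ResolutionOfSingularities.Theorems.FrobeniusClosingSteerZeroDimTowerClimb
import Summits.ResolutionOfSingularities.ResolutionOfSingularities.Theorems.FrobeniusClosingTorsorToLurelPerfectStubPerfectChartOfTemkin
import Literature.AlgebraicGeometry.Resolution.FieldsJ2

/-!
# Steer core, stub S0 `CompositeRankSS`: zero-dimensional LU below `d` from zero-dimensional TORSOR LU below `d`, modulo Temkin's pushed chart

OURS (campaign res-hironaka, rung L, slot W4.1, crux `Steer` stmt-ResolutionOfSingularities-16345, line
`switching_dichotomy` / res-L0-w41-strat-1's `ss-monomial-cycles` §F, registered frontier stub S0 `CompositeRankSS`; prover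
seat res-type-028 gen 8; replaces the role of no printed item; NOT a statement of the manuscript under review; AI-produced,
weaker than expert review). `--supports stmt-ResolutionOfSingularities-16345 --as helper`. Theses-free, definition-free;
CONDITIONAL on the Literature named fact `Temkin2013Relative` (Temkin 2013 = arXiv:0804.1554v3, Thm. 1.3.2, corrected
relative form — the same and only debt of the route item `TorsorToLurelPerfect`, stmt-ResolutionOfSingularities-16162).

THE THEOREM `luZeroDimBelow_of_torsorLUZeroDimBelow`: the skeleton's induction hypothesis «TorsorLUZeroDimBelow p d» (torsor
local uniformization over every PERFECT ground field of characteristic `p`, in transcendence degree `< d`, along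
ZERO-DIMENSIONAL valuation rings — spelled out) implies, given `Temkin2013Relative`, the knot «LUZeroDimBelow p d» of stub S0
(local uniformization of every finitely generated model of a function field of transcendence degree `< d` over a perfect field
of characteristic `p` along a zero-dimensional valuation ring — spelled out, res-type-028's binder text of record). Proof =
the route's own `temkin-leaf` architecture one dimension down: Temkin's Frobenius-pushed chart (`stub_perfectChartOfTemkin`,
tree) at the residue function field, then the radical tower climbed by the ZERO-DIMENSIONAL torsor hypothesis
(`towerAbsorb_zeroDim`, `Theorems/FrobeniusClosingSteerZeroDimTowerClimb.lean`).

CONSEQUENCE for the skeleton (holder's one-liner, nothing registered here): with the (b)-bridge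
`concl_of_exists_discreteCoarsening_of_luZeroDimBelow` (p509580) and `Shannon.discrete_of_stronglySwitching` (p512369),
`stub_compositeRankSS` closes from Steer's OWN binder `TorsorLUZeroDimBelow p n` modulo ⟨`Temkin2013Relative`⟩ — S0 moves from
FRONTIER to NAMED-FACT DEBT already owed by the route.
-/

noncomputable section

-- single-problem summit: the doubled namespace component `ResolutionOfSingularities` is forced
set_option linter.dupNamespace false

open IsLocalRing

namespace Summit.ResolutionOfSingularities.ResolutionOfSingularities.Theorems.ZeroDimTower

open Literature.AlgebraicGeometry.Resolution

/-- **LU below `d` along zero-dimensional valuations from TORSOR LU below `d` along zero-dimensional valuations, modulo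
Temkin's theorem.** Hypotheses: the named fact `Temkin2013Relative`; `p` prime; `hB` = the `Steer` skeleton's
`TorsorLUZeroDimBelow p d` spelled out. Conclusion: for every perfect `k` of characteristic `p`, every field `κ ⊇ k` with
`trdeg_k κ < d`, every valuation ring `O' ⊇ k` of `κ` zero-dimensional over `k`, and every finitely generated `k`-model
`B ⊆ O'` with `Frac B = κ`, some finitely generated `B' ⊇ B` inside `O'` is regular at the centre of `O'`. Proof: `κ/k` is
finitely generated (`IntermediateField.fg_top_of_isFractionRing_of_finiteType`); Temkin's pushed chart
(`stub_perfectChartOfTemkin`: `m`, `A₀ ⊆ O'` regular at the centre, `B ^ {p^m} ⊆ A₀`, `κ ^ {p^m} ⊆ k(A₀)`); field generators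
inside `O'` (`exists_finset_generators_mem`); the tower and absorption `towerAbsorb_zeroDim` fed with `hB` at `k`.
[cite: Temkin2013, Thm. 1.3.2 and Rem. 1.3.5] -/
theorem luZeroDimBelow_of_torsorLUZeroDimBelow
    (hTem : Literature.AlgebraicGeometry.Resolution.Temkin2013Relative.{0}) (p d : ℕ) (hp : p.Prime)
    (hB : ∀ (k K : Type) [Field k] [CharP k p] [PerfectField k] [Field K] [Algebra k K]
      (O : ValuationSubring K) (A₀ : Subalgebra k K) (h₀ : A₀.toSubring ≤ O.toSubring) (t : K),
      Algebra.trdeg k K < (d : Cardinal) →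
      (∀ x ∈ O, ∃ f : Polynomial k, f ≠ 0 ∧ Polynomial.aeval x f ∈ O.nonunits) →
      A₀.FG → t ^ p ∈ A₀ → IsFractionRing (Algebra.adjoin k (insert t (A₀ : Set K))) K →
      IsRegularLocalRing (Localization.AtPrime
        (Ideal.comap (Subring.inclusion h₀) (IsLocalRing.maximalIdeal O))) →
      ∃ (A : Subalgebra k K) (h : A.toSubring ≤ O.toSubring), A₀ ≤ A ∧ t ∈ A ∧ A.FG ∧
        IsFractionRing A K ∧ IsRegularLocalRing (Localization.AtPrime
          (Ideal.comap (Subring.inclusion h) (IsLocalRing.maximalIdeal O)))) :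
    ∀ (k : Type) [Field k] [CharP k p] [PerfectField k] (κ : Type) [Field κ] [Algebra k κ]
      (O' : ValuationSubring κ),
      (∀ c : k, algebraMap k κ c ∈ O') →
      (∀ x : κ, x ∈ O' → ∃ f : Polynomial k, f ≠ 0 ∧ Polynomial.aeval x f ∈ O'.nonunits) →
      Algebra.trdeg k κ < (d : Cardinal) →
      ∀ (B : Subalgebra k κ) (hB : B.toSubring ≤ O'.toSubring), B.FG → IsFractionRing B κ →
        ∃ (B' : Subalgebra k κ) (hB' : B'.toSubring ≤ O'.toSubring), B ≤ B' ∧ B'.FG ∧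
          IsRegularLocalRing (Localization.AtPrime
            ((IsLocalRing.maximalIdeal O').comap (Subring.inclusion hB'))) := by
  intro k _ _ _ κ _ _ O' hk hZ htr B hBO hBfg hfr
  classical
  haveI : Fact p.Prime := ⟨hp⟩
  haveI : Algebra.FiniteType k B := (Subalgebra.fg_iff_finiteType _).mp hBfg
  haveI : IsFractionRing B κ := hfr
  -- `κ / k` is finitely generated
  have hfgtop : (⊤ : IntermediateField k κ).FG :=
    IntermediateField.fg_top_of_isFractionRing_of_finiteType k B κ
  -- Temkin's Frobenius-pushed chart for `(k, κ, O', B)`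
  obtain ⟨m, A₀, h₀, hA₀fg, hRpow, hKpow, hreg₀⟩ :=
    stub_perfectChartOfTemkin hTem p hp k κ hfgtop O' hk B hBfg hBO
  -- field generators inside `O'`
  obtain ⟨G, hGO, hGtop⟩ := exists_finset_generators_mem k κ hfgtop O'
  -- the radical tower climbed with the ZERO-DIMENSIONAL torsor hypothesis over the same perfect `k`
  obtain ⟨A, hA, hBA, hAfg, -, hregA⟩ :=
    towerAbsorb_zeroDim p
      (fun K' _ _ O'' A₀' h₀' t htr' hZ' hfg htp hfr' hreg => hB k K' O'' A₀' h₀' t htr' hZ' hfg htp hfr' hreg)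
      κ O' htr hZ B hBfg hBO G hGO hGtop m A₀ h₀ hA₀fg hreg₀ hRpow (fun g _ => hKpow g)
  exact ⟨A, hA, hBA, hAfg, hregA⟩

end Summit.ResolutionOfSingularities.ResolutionOfSingularities.Theorems.ZeroDimTower
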